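import Summits.ABC.IUTFork.Joshi.TestRealIsmDichotomy
import Summits.ABC.IUTFork.Joshi.TestRealInstantiation
import Summits.ABC.IUTFork.Cor312SettingDHVolWitness
import HarnessLib

/-!
# Branch E TEST vs S — REAL-LEVEL NON-VACUITY: an HONEST PACKET at the tree's real carriers (the binders
# `ThetaRegionsAdm`/`hq`/`hΘ`/`hlt` of X-06-REAL and X-12-REAL DISCHARGED; abc-iut-E-t41, item named by abc-iut-E-cx 09:41:25Z)

Record file of the abc-iut cell, block E (rung LADDER-ABC:A2.E). abc-iut-E-t43's real-carrier theorems — X-06-REAL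
`realDH_not_indCoversQ` (p430041) and THE REAL-GENERIC DICHOTOMY `real_not_indCoversQ_or_not_statement` (p435161) — carry the
HONEST-PACKET hypotheses as BINDERS: `ThetaRegionsAdm`, and at ONE packet `(j = i+1, v_ℚ)` the `q`-datum region admissible (`hq`),
every column-`m` Θ-datum region admissible (`hΘ`) of STRICTLY SMALLER log-volume (`hlt`). THIS FILE INSTANCES THEM in the verbatim
Dupuy–Hilado container for EVERY choice of the (Ind1)/(Ind2) binders `Aut`/`Ism` of abc-iut-c312-5's generic real shells
`Thm311.Real.logShells X logv Aut Ism`, every column family `col`, every column `n`: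
* `honestSetting`: c312-7's `Setting.ofComparison` over E-t43's `latticeSituationReal` (verbatim volumes) from c312-5's
  field-factor pieces (`factorIdxDH`/`factorFieldDH`/`factorMapDH`), the one-point context data of `Cor312SettingDHVolWitness`, and
  PRINTED-SHAPE pilot boxes at a fixed prime `p`: every `(n, m)`-Kummer image of the Θ-pilot is the line bundle `p·𝒪_L` — over `p`
  the direct product over the summands of `p·(R_{v⃗})^∼` ([IUTchIV] Prop. 1.4 (i) `μ^log(p·(R_E)^∼) = −log p`) —, the `q`-pilot
  image is `𝒪_L` (Dupuy–Hilado normalisation `log μ̄((R)^∼) = 0`); `hadm`/`hfin` PROVED (`hadm_real`, `hfin_real_one`).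
* DISCHARGED by the tree's measure theory alone: `thetaRegionsAdm_honestSetting`, `honestSetting_qRegion_adm`,
  `honestSetting_logvol_qRegion` (`= 0` everywhere), `honestSetting_logvol_thetaRegion_neg` (over `p`: `Σ_{v⃗} w_{v⃗}·log μ̄(p·(R_{v⃗})^∼)
  = −(#v⃗)·log p/[F:ℚ]^{j+1} < 0`, DERIVED from abc-iut-c312-3's modulus law `packetLogμ_ppow_smul`; no number posited).
* `honest_not_indCoversQ_or_not_statement` — **X-12-REAL IS NON-VACUOUS**: for every `Aut`/`Ism` (finite-place members continuous),
  `col`, and every reading `ρ` / `q`-datum `qK` satisfying THE COROLLARY'S OWN TWO REGION PINS at this setting ((pΘ)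
  `thetaRegion m = ρ (frobΨ m)`, (pq′) `qRegion = ρ qK`; `Cor312PinnedRegions`), p435161's binders are supplied by `exact` at
  `(j = 1, v_ℚ = p)` and the dichotomy FIRES at an INHABITED real setting. Companion `Joshi/TestRealHonestPacketDH.lean`:
  X-06-REAL non-vacuity at the Dupuy–Hilado binders (`¬IndCoversQ` outright) and the existence of pinned readings.

HONEST SCOPE: a non-vacuity witness for the INTERFACES of X-06-REAL / X-12-REAL (discipline of c312-5's `Cor312SettingDHVolWitness`).
The boxes carry the printed SHAPE of the pilot line bundles ([IUTchIII] Rmk. 3.9.5 (vii) (Ob1); Dupuy–Hilado Def. 3.6.1) with honest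
exponents (Θ strictly below `q` at `p`); they are NOT the Θ-pilot object of [IUTchIII] Def. 3.8 (i). The (hρ)-equivariance half of the
Θ-pin and Thm. 3.11 (ii)(b) are NOT discharged here (the S-form `real_not_pilotKummerIndRelated_or_not_statement` keeps them). The
rescaling-horn INSTANCE (`Ism ∋ x ↦ p·x` ⟹ second disjunct) is E-t43's companion over THIS setting. **No side is taken** on [IUTchIII] Cor. 3.12 or on any author (Mochizuki / Scholze–Stix / Joshi /
Dupuy–Hilado); typed ≠ proved ≠ endorsed; located, not adjudicated. [claim: Mochizuki2012, status: disputed]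
[cite: DupuyHilado2025, Def. 3.6.1, §4.7–4.9] [cite: Mochizuki2012, IUTchIV Prop. 1.4 (i) p. 13]. Standard axioms only; no `sorry`.
-/

noncomputable section

open Set Function
open scoped Pointwise

namespace Summit.ABC.IUTFork.Joshi

open Thm311 Thm311.Real Cor312 Cor312Vol Literature.IUT.LogThetaLattice Literature.IUT.LogVolume

/-! ## 0. `ψ⁻¹(p·𝒪_L) = p·(R_I)^∼`, of normalised log-measure `−log p` -/

section Prime

variable (p : ℕ) [hp : Fact p.Prime] {I : Type} [Fintype I] [DecidableEq I] [Nonempty I]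
  (k : I → Type) [∀ i, NontriviallyNormedField (k i)] [∀ i, NormedAlgebra ℚ_[p] (k i)]
  [∀ i, IsUltrametricDist (k i)] [∀ i, ProperSpace (k i)]

/-- **`ψ⁻¹(p·𝒪_L) = p·(R_I)^∼`**: the preimage under abc-iut-c312-3's decomposition `ψ : X_{v⃗} ≃ Π_j L_j` of the hull-set
`p·𝒪_L = Π_j p·𝒪_{L_j}` is the `p`-multiple of the normalized packet. [cite: Mochizuki2012, IUTchIV Prop. 1.4 (i) p. 13] -/
theorem preimage_dEquiv_hullSet_prime :
    dEquiv p k ⁻¹' hullSet (DFac p k) (fun j => (p : DFac p k j)) =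
      ppow p k 1 • (normalizedPacket p k : Set (PacketAlgebra p k)) := by
  have hg : dEquiv p k (ppow p k 1) = fun j => (p : DFac p k j) :=
    funext fun j => by rw [psi_ppow_apply, zpow_one]
  have hc : ∀ j, (fun j => (p : DFac p k j)) j ≠ 0 := fun j => prime_ne_zero p (DFac p k j)
  rw [← Set.preimage_image_eq (ppow p k 1 • (normalizedPacket p k : Set (PacketAlgebra p k))) (dEquiv p k).injective,
    image_smul_eq, image_normalizedPacket_eq_coe, coe_piUnitBallStructure, hg, hullSet_eq_image_mul _ _ hc]

/-- `p·(R_I)^∼` is admissible (positive finite Haar measure). [cite: DupuyHilado2025, Def. 3.6.1] -/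
theorem packetAdm_ppow_one_smul_normalizedPacket :
    PacketAdm p k (ppow p k 1 • (normalizedPacket p k : Set (PacketAlgebra p k))) :=
  packetAdm_smul_normalizedPacket p k _ fun j => by
    rw [psi_ppow_apply]; exact zpow_ne_zero _ (prime_ne_zero p (DFac p k j))

/-- **`log μ̄(p·(R_I)^∼) = −log p`** — the Haar MODULUS of `x ↦ p·x` ("Mochizuki normalized"; abc-iut-c312-3's
`packetLogμ_ppow_smul`), derived, not posited. [cite: Mochizuki2012, IUTchIV Prop. 1.4 (i) p. 13] -/
theorem packetLogμ_ppow_one_smul_normalizedPacket :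
    packetLogμ p k (ppow p k 1 • (normalizedPacket p k : Set (PacketAlgebra p k))) = -Real.log p := by
  rw [packetLogμ_ppow_smul p k 1 (packetAdm_normalizedPacket p k), packetLogμ_normalizedPacket]
  simp

end Prime

/-! ## 1. The field-factor pieces READ ON the generic real shells: `hadm`, `hfin`; the honest setting -/

section Honest

variable {F : Type} [Field F] [NumberField F] (X : PilotData F) {logv : PadicLogs F} (hlog : LogvAnalytic logv)
  (Aut Ism : ∀ x : Place F, Set (Carrier x ≃ₗ[ℚ] Carrier x))
  (hAut : ∀ x, LinearEquiv.refl ℚ (Carrier x) ∈ Aut x) (hIsm : ∀ x, LinearEquiv.refl ℚ (Carrier x) ∈ Ism x)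
  (M : Type) [Field M] [NumberField M]
  (archPk : ∀ (j : (thetaIndex X).Label) (vQ : (thetaIndex X).VQ), Set ((logShells X logv Aut Ism hAut hIsm).Packet j vQ))
  (archSub : ∀ (j : (thetaIndex X).Label) (v : (thetaIndex X).V),
    Set ((logShells X logv Aut Ism hAut hIsm).Packet j ((thetaIndex X).over v)))
  (Ψ : ℤ → ∀ v : (thetaIndex X).V, v ∈ (thetaIndex X).Vbad → Set ((logShells X logv Aut Ism hAut hIsm).StarPacket v))
  (act : ℤ → ∀ v : (thetaIndex X).V, v ∈ (thetaIndex X).Vbad →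
    (logShells X logv Aut Ism hAut hIsm).StarPacket v → Module.End ℚ ((logShells X logv Aut Ism hAut hIsm).StarPacket v))
  (Mmod : ℤ → ∀ j : (thetaIndex X).LabelStar, Set ((logShells X logv Aut Ism hAut hIsm).GlobalPacket j.1))
  (region : ℤ → ∀ j : (thetaIndex X).LabelStar, FinDivisor M → ∀ vQ : (thetaIndex X).VQ,
    Set ((logShells X logv Aut Ism hAut hIsm).Packet j.1 vQ))
  (col : ℤ → Column (logShells X logv Aut Ism hAut hIsm)) (n : ℤ) (p : ℕ) [hp : Fact p.Prime]

/-- `p ≠ 0` in every field factor `L_{v⃗,i}` of every real packet (characteristic `0`; no factor at `∞`). [folklore] -/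
theorem natCast_prime_ne_zero_factorFieldDH : ∀ (j : (thetaIndex X).Label) (vQ : (thetaIndex X).VQ)
    (s : factorIdxDH X hlog j vQ), (p : factorFieldDH X hlog j vQ s) ≠ 0
  | _, .inl _, s => s.elim
  | j, .inr pp, s => by
    haveI : Fact (pp : ℕ).Prime := ⟨pp.2⟩
    haveI : CharZero (DFac (pp : ℕ) ((presAt X hlog pp).kk s.1) s.2) :=
      charZero_of_injective_algebraMap (algebraMap ℚ_[pp] (DFac (pp : ℕ) ((presAt X hlog pp).kk s.1) s.2)).injective
    show (p : DFac (pp : ℕ) ((presAt X hlog pp).kk s.1) s.2) ≠ 0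
    exact Nat.cast_ne_zero.2 hp.out.ne_zero

/-- **`hadm` on the generic real shells**: the preimage under the field-factor comparison of every hull-set `λ·𝒪_L` is an
admissible region of every line of `latticeSituationReal` (c312-5's `hadm_DH` read on the re-typed container). [claim: Mochizuki2012, status: disputed] -/
theorem hadm_real : ∀ (j : (thetaIndex X).Label) (vQ : (thetaIndex X).VQ)
    (H : Set (∀ s : factorIdxDH X hlog j vQ, factorFieldDH X hlog j vQ s)), IsHullSet (factorFieldDH X hlog j vQ) H →
      ((latticeSituationReal X hlog Aut Ism hAut hIsm M archPk archSub Ψ act Mmod region col).D n).Adm j vQ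
        ((fun x => factorMapDH X hlog j vQ x) ⁻¹' H)
  | j, .inl u, H, hH => by
    refine (LocalPieces.adm_trivial_iff (logShellsDH X logv) (.inl u) j _).2 ⟨0, ?_⟩
    obtain ⟨c, -, rfl⟩ := hH
    show factorMapDH X hlog j (.inl u) 0 ∈ hullSet _ c
    rw [hullSet, mem_polydisc]
    exact fun s => s.elim
  | j, .inr pp, H, hH => by
    haveI : Fact (pp : ℕ).Prime := ⟨pp.2⟩
    exact (presAt X hlog pp).adm_preimage_of_isHullSet j hH

/-- At `∞` every region has log-volume `0` (trivial archimedean container). [cite: DupuyHilado2025, Def. 3.6.3] -/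
theorem logvol_real_inl (j : (thetaIndex X).Label) (u : Unit) (A : Set ((logShells X logv Aut Ism hAut hIsm).Packet j (.inl u))) :
    ((latticeSituationReal X hlog Aut Ism hAut hIsm M archPk archSub Ψ act Mmod region col).D n).logvol j (.inl u) A = 0 := by
  refine ((realizes_latticeSituationReal X hlog Aut Ism hAut hIsm M archPk archSub Ψ act Mmod region col n).logvol_eq
    j (.inl u) A).trans (Finset.sum_eq_zero fun e _ => ?_)
  rw [show (summandPiecesReal X hlog Aut Ism hAut hIsm).w j (.inl u) e = 0 from rfl, zero_mul]

/-- The log-volume of `e⁻¹(Π_{v⃗} (R_{v⃗})^∼)` VANISHES at every prime (`log μ̄((R)^∼) = 0`). [cite: DupuyHilado2025, Def. 3.6.1] -/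
theorem logvol_real_preimage_normalizedPacket (j : (thetaIndex X).Label) (pp : Nat.Primes) :
    haveI : Fact (pp : ℕ).Prime := ⟨pp.2⟩
    ((latticeSituationReal X hlog Aut Ism hAut hIsm M archPk archSub Ψ act Mmod region col).D n).logvol j (.inr pp)
      ((presAt X hlog pp).comparison j ⁻¹' Set.pi univ fun e =>
        (normalizedPacket (pp : ℕ) ((presAt X hlog pp).kk e) : Set ((presAt X hlog pp).X e))) = 0 := by
  haveI : Fact (pp : ℕ).Prime := ⟨pp.2⟩
  haveI : Nonempty ((thetaIndex X).Caps j) := ⟨0⟩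
  refine ((realizes_latticeSituationReal X hlog Aut Ism hAut hIsm M archPk archSub Ψ act Mmod region col n).logvol_eq
    j (.inr pp) _).trans ((SummandPieces.logvol_preimage_pi (summandPiecesReal X hlog Aut Ism hAut hIsm) j (.inr pp)
    (R := fun e => (normalizedPacket (pp : ℕ) ((presAt X hlog pp).kk e) : Set ((presAt X hlog pp).X e)))
    (fun e => (presAt X hlog pp).packetAdm_normalizedPacket_kk e)).trans (Finset.sum_eq_zero fun e _ => ?_))
  show weightDH X j * packetLogμ (pp : ℕ) ((presAt X hlog pp).kk e) (normalizedPacket (pp : ℕ) ((presAt X hlog pp).kk e)) = 0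
  rw [packetLogμ_normalizedPacket, mul_zero]

/-- **`hfin` for the unit `q`-centre**: the `q`-hull-set `e⁻¹(𝒪_L)` has log-volume `0` at EVERY place (empty support). [folklore] -/
theorem hfin_real_one (j : (thetaIndex X).Label) :
    (Function.support fun vQ : (thetaIndex X).VQ =>
      ((latticeSituationReal X hlog Aut Ism hAut hIsm M archPk archSub Ψ act Mmod region col).D n).logvol j vQ
        ((fun x => factorMapDH X hlog j vQ x) ⁻¹' hullSet (factorFieldDH X hlog j vQ) (fun _ => 1))).Finite := by
  refine Set.finite_empty.subset fun vQ hvQ => ?_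
  rcases vQ with u | pp
  · exact hvQ (logvol_real_inl X hlog Aut Ism hAut hIsm M archPk archSub Ψ act Mmod region col n j u _)
  · exact hvQ ((congrArg (((latticeSituationReal X hlog Aut Ism hAut hIsm M archPk archSub Ψ act Mmod region col).D
        n).logvol j (.inr pp)) (preimage_factorMapDH_hullSet_one X hlog j pp)).trans
      (logvol_real_preimage_normalizedPacket X hlog Aut Ism hAut hIsm M archPk archSub Ψ act Mmod region col n j pp))

/-- **THE HONEST SETTING over the generic real shells with the verbatim volumes**: c312-7's `Setting.ofComparison` at column `n`
with the one-point context data of `Cor312SettingDHVolWitness` and the field-factor pieces VERBATIM c312-5's (`factorIdxDH`,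
`factorFieldDH`, `factorMapDH`) carrying the printed-shape boxes (Θ: `p·𝒪_L` everywhere; `q`-centre `1`); `hadm`/`hfin` PROVED. For EVERY
`Aut`/`Ism`/`col`. A witness for the interfaces of X-06-REAL / X-12-REAL, NOT a model of [IUTchIII] Def. 3.8 (i).
[claim: Mochizuki2012, status: disputed] -/
def honestSetting :
    Cor312.Setting (latticeSituationReal X hlog Aut Ism hAut hIsm M archPk archSub Ψ act Mmod region col).toSituation :=
  Setting.ofComparison n unitLatticeDH (unitSigDH X) (unitSplitDH X) (unitQDataDH X)
    -- the field-factor pieces VERBATIM c312-5's; Θ-boxes `p·𝒪_L` at every `(m, j, v_ℚ)`; `q`-centre `1`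
    { J := factorIdxDH X hlog
      instFintype := factorIdxDH_fintype X hlog
      K := factorFieldDH X hlog
      instField := factorFieldDH_field X hlog
      instUltra := factorFieldDH_ultra X hlog
      instProper := factorFieldDH_proper X hlog
      e := fun j vQ x => factorMapDH X hlog j vQ x
      thetaBox := fun _ _ j vQ => hullSet (factorFieldDH X hlog j vQ) fun s => (p : factorFieldDH X hlog j vQ s)
      qCentre := fun _ _ _ => fun _ => 1 }
    (fun j vQ s => (one_ne_zero : (1 : factorFieldDH X hlog j vQ s) ≠ 0))
    (hadm_real X hlog Aut Ism hAut hIsm M archPk archSub Ψ act Mmod region col n)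
    (hfin_real_one X hlog Aut Ism hAut hIsm M archPk archSub Ψ act Mmod region col n)

omit hp in
/-- Its `m`-th Θ-region at `(j, v_ℚ)` is `e⁻¹(p·𝒪_L)`, the same for every `m`; its column is `n` (`rfl`). [folklore] -/
theorem honestSetting_thetaRegion (m : ℤ) (j : (thetaIndex X).Label) (vQ : (thetaIndex X).VQ) :
    (honestSetting X hlog Aut Ism hAut hIsm M archPk archSub Ψ act Mmod region col n p).thetaRegion m j vQ =
      (fun x => factorMapDH X hlog j vQ x) ⁻¹' hullSet (factorFieldDH X hlog j vQ) (fun s => (p : factorFieldDH X hlog j vQ s)) :=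
  rfl

omit hp in
/-- Its `q`-region at `(j, v_ℚ)` is `e⁻¹(𝒪_L)`. [folklore] -/
theorem honestSetting_qRegion (j : (thetaIndex X).Label) (vQ : (thetaIndex X).VQ) :
    (honestSetting X hlog Aut Ism hAut hIsm M archPk archSub Ψ act Mmod region col n p).qRegion j vQ =
      (fun x => factorMapDH X hlog j vQ x) ⁻¹' hullSet (factorFieldDH X hlog j vQ) (fun _ => 1) :=
  rfl

/-! ## 2. The honest-packet binders DISCHARGED: admissibility everywhere, log-volumes `0` vs. `< 0` over `p` -/

variable {X hlog Aut Ism hAut hIsm M archPk archSub Ψ act Mmod region col n p}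

/-- EVERY Θ-region at EVERY packet is admissible (a hull-set with nonzero centre `p`). [claim: Mochizuki2012, status: disputed] -/
theorem honestSetting_thetaRegion_adm (m : ℤ) (j : (thetaIndex X).Label) (vQ : (thetaIndex X).VQ) :
    ((latticeSituationReal X hlog Aut Ism hAut hIsm M archPk archSub Ψ act Mmod region col).D n).Adm j vQ
      ((honestSetting X hlog Aut Ism hAut hIsm M archPk archSub Ψ act Mmod region col n p).thetaRegion m j vQ) :=
  hadm_real X hlog Aut Ism hAut hIsm M archPk archSub Ψ act Mmod region col n j vQ _
    ⟨fun s => (p : factorFieldDH X hlog j vQ s), natCast_prime_ne_zero_factorFieldDH X hlog p j vQ, rfl⟩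

/-- **`ThetaRegionsAdm` DISCHARGED** for the honest setting. [claim: Mochizuki2012, status: disputed] -/
theorem thetaRegionsAdm_honestSetting :
    ThetaRegionsAdm (honestSetting X hlog Aut Ism hAut hIsm M archPk archSub Ψ act Mmod region col n p) :=
  fun m i vQ => honestSetting_thetaRegion_adm m (Setting.labelSucc i) vQ

omit hp in
/-- The `q`-region at every packet is admissible (the hull-set `𝒪_L`). [claim: Mochizuki2012, status: disputed] -/
theorem honestSetting_qRegion_adm (j : (thetaIndex X).Label) (vQ : (thetaIndex X).VQ) :
    ((latticeSituationReal X hlog Aut Ism hAut hIsm M archPk archSub Ψ act Mmod region col).D n).Adm j vQ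
      ((honestSetting X hlog Aut Ism hAut hIsm M archPk archSub Ψ act Mmod region col n p).qRegion j vQ) :=
  hadm_real X hlog Aut Ism hAut hIsm M archPk archSub Ψ act Mmod region col n j vQ _ ⟨fun _ => 1, fun _ => one_ne_zero, rfl⟩

omit hp in
/-- The `q`-region has log-volume `0` at EVERY packet. [cite: DupuyHilado2025, Def. 3.6.1] -/
theorem honestSetting_logvol_qRegion (j : (thetaIndex X).Label) (vQ : (thetaIndex X).VQ) :
    ((latticeSituationReal X hlog Aut Ism hAut hIsm M archPk archSub Ψ act Mmod region col).D n).logvol j vQ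
      ((honestSetting X hlog Aut Ism hAut hIsm M archPk archSub Ψ act Mmod region col n p).qRegion j vQ) = 0 := by
  rcases vQ with u | pp
  · exact logvol_real_inl X hlog Aut Ism hAut hIsm M archPk archSub Ψ act Mmod region col n j u _
  · exact (congrArg (((latticeSituationReal X hlog Aut Ism hAut hIsm M archPk archSub Ψ act Mmod region col).D
        n).logvol j (.inr pp)) (preimage_factorMapDH_hullSet_one X hlog j pp)).trans
      (logvol_real_preimage_normalizedPacket X hlog Aut Ism hAut hIsm M archPk archSub Ψ act Mmod region col n j pp)

variable (X hlog p) in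
/-- **Over `p` the Θ-region is `e⁻¹(Π_{v⃗} p·(R_{v⃗})^∼)`** — the direct product over the summands of the `p`-multiples of the
normalized packets. [cite: Mochizuki2012, IUTchIV Prop. 1.4 (i) p. 13] -/
theorem preimage_factorMapDH_hullSet_prime (j : (thetaIndex X).Label) :
    (fun x => factorMapDH X hlog j (.inr (ratPrime p)) x) ⁻¹'
        hullSet (factorFieldDH X hlog j (.inr (ratPrime p))) (fun s => (p : factorFieldDH X hlog j (.inr (ratPrime p)) s)) =
      (presAt X hlog (ratPrime p)).comparison j ⁻¹' Set.pi univ fun e =>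
        ppow p ((presAt X hlog (ratPrime p)).kk e) 1 •
          (normalizedPacket p ((presAt X hlog (ratPrime p)).kk e) : Set ((presAt X hlog (ratPrime p)).X e)) := by
  haveI : Nonempty ((thetaIndex X).Caps j) := ⟨0⟩
  refine Eq.trans (b := (fun x => (presAt X hlog (ratPrime p)).factorMap j x) ⁻¹'
    hullSet ((presAt X hlog (ratPrime p)).factorField j) (fun s => (p : (presAt X hlog (ratPrime p)).factorField j s))) rfl ?_
  rw [PadicPresentation.factorMap_preimage_hullSet]
  exact congrArg (fun R : ∀ e, Set ((presAt X hlog (ratPrime p)).X e) =>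
      ((presAt X hlog (ratPrime p)).comparison j : _ → _) ⁻¹' Set.pi univ R)
    (funext fun e => preimage_dEquiv_hullSet_prime p ((presAt X hlog (ratPrime p)).kk e))

/-- **HONEST EXPONENTS AT `p`: the Θ-regions have STRICTLY NEGATIVE log-volume there** — `Σ_{v⃗} w_{v⃗}·log μ̄(p·(R_{v⃗})^∼) =
−(#v⃗)·log p/[F:ℚ]^{j+1} < 0`, from the Haar MODULUS of `x ↦ p·x` and positive weights; DERIVED, no number posited.
[cite: Mochizuki2012, IUTchIV Prop. 1.4 (i) p. 13] -/
theorem honestSetting_logvol_thetaRegion_neg (m : ℤ) (j : (thetaIndex X).Label) :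
    ((latticeSituationReal X hlog Aut Ism hAut hIsm M archPk archSub Ψ act Mmod region col).D n).logvol j (.inr (ratPrime p))
      ((honestSetting X hlog Aut Ism hAut hIsm M archPk archSub Ψ act Mmod region col n p).thetaRegion m j
        (.inr (ratPrime p))) < 0 := by
  haveI : Nonempty ((thetaIndex X).Caps j) := ⟨0⟩
  haveI : Nonempty ((summandPiecesReal X hlog Aut Ism hAut hIsm).E j (.inr (ratPrime p))) :=
    let ⟨v, hv⟩ := (thetaIndex X).fibre_nonempty (.inr (ratPrime p)); ⟨fun _ => ⟨v, hv⟩⟩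
  rw [honestSetting_thetaRegion, preimage_factorMapDH_hullSet_prime]
  refine lt_of_eq_of_lt (((realizes_latticeSituationReal X hlog Aut Ism hAut hIsm M archPk archSub Ψ act Mmod region col
    n).logvol_eq j (.inr (ratPrime p)) _).trans (SummandPieces.logvol_preimage_pi
      (summandPiecesReal X hlog Aut Ism hAut hIsm) j (.inr (ratPrime p))
      (R := fun e => ppow p ((presAt X hlog (ratPrime p)).kk e) 1 •
        (normalizedPacket p ((presAt X hlog (ratPrime p)).kk e) : Set ((presAt X hlog (ratPrime p)).X e)))
      (fun e => packetAdm_ppow_one_smul_normalizedPacket p ((presAt X hlog (ratPrime p)).kk e)))) ?_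
  refine Finset.sum_neg (fun e _ => ?_) Finset.univ_nonempty
  show weightDH X j * packetLogμ p ((presAt X hlog (ratPrime p)).kk e)
    (ppow p ((presAt X hlog (ratPrime p)).kk e) 1 •
      (normalizedPacket p ((presAt X hlog (ratPrime p)).kk e) : Set ((presAt X hlog (ratPrime p)).X e))) < 0
  have hw : 0 < weightDH X j := by  -- the weights `1/[F:ℚ]^{j+1}` are positive (tree: `Real.weightDH_pos`)
    unfold weightDH
    have h : (0 : ℝ) < (Module.finrank ℚ F : ℝ) := Nat.cast_pos.2 Module.finrank_pos
    positivity
  rw [packetLogμ_ppow_one_smul_normalizedPacket]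
  exact mul_neg_of_pos_of_neg hw (neg_neg_of_pos (Real.log_pos (by exact_mod_cast hp.out.one_lt)))

/-! ## 3. Pinned readings: the binders of X-12-REAL / X-06-REAL supplied by `exact` -/

variable (ρ : (∀ v : (thetaIndex X).V, v ∈ (thetaIndex X).Vbad → Set ((logShells X logv Aut Ism hAut hIsm).StarPacket v)) →
    ∀ (j : (thetaIndex X).Label) (vQ : (thetaIndex X).VQ), Set ((logShells X logv Aut Ism hAut hIsm).Packet j vQ))
  (qK : ∀ v : (thetaIndex X).V, v ∈ (thetaIndex X).Vbad → Set ((logShells X logv Aut Ism hAut hIsm).StarPacket v))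

omit hp in
/-- Under (pq′) the `q`-datum region is admissible at every packet (`hq`). [claim: Mochizuki2012, status: disputed] -/
theorem honest_hq
    (hqpin : ∀ (j : (thetaIndex X).Label) (vQ : (thetaIndex X).VQ),
      (honestSetting X hlog Aut Ism hAut hIsm M archPk archSub Ψ act Mmod region col n p).qRegion j vQ = ρ qK j vQ)
    (j : (thetaIndex X).Label) (vQ : (thetaIndex X).VQ) :
    ((latticeSituationReal X hlog Aut Ism hAut hIsm M archPk archSub Ψ act Mmod region col).D n).Adm j vQ (ρ qK j vQ) := by
  rw [← hqpin]
  exact honestSetting_qRegion_adm j vQ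

/-- Under (pΘ) every column-`m` Θ-datum region is admissible at every packet (`hΘ`). [claim: Mochizuki2012, status: disputed] -/
theorem honest_hΘ
    (hΘpin : ∀ (m : ℤ) (j : (thetaIndex X).Label) (vQ : (thetaIndex X).VQ),
      (honestSetting X hlog Aut Ism hAut hIsm M archPk archSub Ψ act Mmod region col n p).thetaRegion m j vQ =
        ρ ((col n).frobΨ m) j vQ)
    (m : ℤ) (j : (thetaIndex X).Label) (vQ : (thetaIndex X).VQ) :
    ((latticeSituationReal X hlog Aut Ism hAut hIsm M archPk archSub Ψ act Mmod region col).D n).Adm j vQ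
      (ρ ((col n).frobΨ m) j vQ) := by
  rw [← hΘpin]
  exact honestSetting_thetaRegion_adm m j vQ

/-- Under both pins, over `p`, every Θ-datum region is STRICTLY SMALLER in log-volume than the `q`-datum region (`hlt`).
[claim: Mochizuki2012, status: disputed] -/
theorem honest_hlt
    (hΘpin : ∀ (m : ℤ) (j : (thetaIndex X).Label) (vQ : (thetaIndex X).VQ),
      (honestSetting X hlog Aut Ism hAut hIsm M archPk archSub Ψ act Mmod region col n p).thetaRegion m j vQ =
        ρ ((col n).frobΨ m) j vQ)
    (hqpin : ∀ (j : (thetaIndex X).Label) (vQ : (thetaIndex X).VQ),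
      (honestSetting X hlog Aut Ism hAut hIsm M archPk archSub Ψ act Mmod region col n p).qRegion j vQ = ρ qK j vQ)
    (m : ℤ) (j : (thetaIndex X).Label) :
    ((latticeSituationReal X hlog Aut Ism hAut hIsm M archPk archSub Ψ act Mmod region col).D n).logvol j
        (.inr (ratPrime p)) (ρ ((col n).frobΨ m) j (.inr (ratPrime p))) <
      ((latticeSituationReal X hlog Aut Ism hAut hIsm M archPk archSub Ψ act Mmod region col).D n).logvol j
        (.inr (ratPrime p)) (ρ qK j (.inr (ratPrime p))) := by
  rw [← hΘpin, ← hqpin, honestSetting_logvol_qRegion]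
  exact honestSetting_logvol_thetaRegion_neg m j

/-- **X-12-REAL IS NON-VACUOUS — `honest_not_indCoversQ_or_not_statement`.** For EVERY `Aut`/`Ism` (members at finite places
continuous), every column family, and every region reading `ρ` / `q`-datum `qK` satisfying the Corollary's own two region pins at
the honest setting, abc-iut-E-t43's REAL-GENERIC DICHOTOMY (p435161) FIRES with its honest-packet binders (`ThetaRegionsAdm`, `hq`,
`hΘ`, `hlt` at `(j = 1, v_ℚ = p)`) supplied by `exact`: EITHER no element of `⟨(Ind1) ∪ (Ind2)⟩` carries a Θ-datum region over the
`q`-datum region OR the printed Statement ∧ `BridgeHyps` fail AS TYPED. Located, not adjudicated.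
[claim: Mochizuki2012, status: disputed] [claim: Joshi2024ATS3, status: disputed] -/
theorem honest_not_indCoversQ_or_not_statement
    (hAc : ∀ (v : IsDedekindDomain.HeightOneSpectrum (NumberField.RingOfIntegers F)), ∀ g ∈ Aut (.inr v), Continuous g)
    (hIc : ∀ (v : IsDedekindDomain.HeightOneSpectrum (NumberField.RingOfIntegers F)), ∀ g ∈ Ism (.inr v), Continuous g)
    (hΘpin : ∀ (m : ℤ) (j : (thetaIndex X).Label) (vQ : (thetaIndex X).VQ),
      (honestSetting X hlog Aut Ism hAut hIsm M archPk archSub Ψ act Mmod region col n p).thetaRegion m j vQ =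
        ρ ((col n).frobΨ m) j vQ)
    (hqpin : ∀ (j : (thetaIndex X).Label) (vQ : (thetaIndex X).VQ),
      (honestSetting X hlog Aut Ism hAut hIsm M archPk archSub Ψ act Mmod region col n p).qRegion j vQ = ρ qK j vQ) :
    ¬ IndCoversQ (latticeSituationReal X hlog Aut Ism hAut hIsm M archPk archSub Ψ act Mmod region col)
        (honestSetting X hlog Aut Ism hAut hIsm M archPk archSub Ψ act Mmod region col n p) ρ qK ∨
      (¬ (honestSetting X hlog Aut Ism hAut hIsm M archPk archSub Ψ act Mmod region col n p).Statement ∧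
        ¬ BridgeHyps (honestSetting X hlog Aut Ism hAut hIsm M archPk archSub Ψ act Mmod region col n p)) :=
  real_not_indCoversQ_or_not_statement X hlog Aut Ism hAut hIsm M archPk archSub Ψ act Mmod region col ρ qK hAc hIc
    thetaRegionsAdm_honestSetting (i := ⟨0, lt_of_lt_of_le Nat.zero_lt_two (thetaIndex X).two_le_lstar⟩)
    (vQ := .inr (ratPrime p)) (honest_hq ρ qK hqpin _ _)
    (fun m => honest_hΘ ρ hΘpin m _ _) (fun m => honest_hlt ρ qK hΘpin hqpin m _)

end Honest

end Summit.ABC.IUTFork.Joshi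

end
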